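import Summits.RiemannHypothesis.RiemannHypothesis.Theorems.TiltedLandingLaw421R3Lens1ArcSignN

/-!
# «NoLanding» — SKETCH v2 (lens-1 g10; frame-free (M)-small piece for the exact NEG-20 row, NODE v31 §0′)

Nothing here bears on the truth of RH; RH is not proved.  Two frame-free lemmas and one corollary over part N's `LinkCore`:

* `im_pos_above_of_re_deriv_pos` — if `φ` is ℂ-differentiable along the vertical segment `{x + i t : 0 ≤ t ≤ y}` (`0 < y`), `Im φ x = 0` and
  `0 < Re φ′` on the segment, then `0 < Im φ (x + i y)` (the function `t ↦ Im φ (x + i t)` has derivative `Re φ′ (x + i t) > 0`).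
* `linkCore_noLanding` — FIRST-CONTACT COROLLARY: a `LinkCore` path (nodal for `Im φ`, `φ = phiAt f j`) whose points `σ s` (for `s < s₀` close to `s₀`)
  lie strictly above the axis cannot reach at `s₀` an axis point `x⋆` above which `φ` is differentiable with `0 < Re φ′` on a box and real on the
  real axis: for `s` close to `s₀` the point `σ s` lies in the box, so `Im φ (σ s) > 0`, contradicting nodality.

USE (NEG 20, symmetric sub-band wall `{±i, ±17/10 ± 7/8·i}`, tilt 0): with `φ′ = (PP″ − P′²)/P² > 0` on the base `[-1, 1]` (one Sturm sign) the corollary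
forbids any nodal path from `T = i` to touch the base, so the pay point that part N's `exists_crit_of_halfLink` extracts from a half-link is non-real —
and the non-real zeros of `P′` lie outside the closed disc (two rational inequalities).  Floats decide nothing; the certificate is C6's.
-/

namespace RhW08.Lens1NoLanding

open Complex Set Metric Filter Topology
open scoped Real ComplexConjugate
open Literature.Topology.PlaneTopology Literature.Analysis.Complex
open Summit.RiemannHypothesis.RiemannHypothesis.Theorems.Splittings.JensenWindow
open RhIdea6.G17.W07C7 RhIdea6.G17.W07C7.Rev6 RhIdea6.G18.W07C8.Law421BirthS RhIdea6.G19.W07C11.Seam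
open RhIdea6.G20.W07C12.Frac RhIdea6.G20.W07C12.StColP RhW07.C12.FieldSplit RhIdea6.G21.W07C13.TentMax
open RhW07.C14.TwoSided RhW07.C14.Classes RhW07.C14.Lineage RhW07.C14.Booking
open RhW07.C13.Heredity RhIdea6.G22.W07C15pre.Injection RhW07.E3.Cell RhW07.E3.Lit
open RhW08.Round1 RhW08.StSwap RhW08.Round2 RhW08.QuadW RhW08.SealSwapQ RhW08.SealSwap RhW08.SuccB RhW08.SuccSplit
open RhW08.SuccTheft RhW08.Column RhW08.Hurwitz RhW08.ClusterQ RhW08.ClusterQM RhW08.NewtonDoor RhW08.NewtonDoorGenusOne RhW08.PurseP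
open RhW08.Lens1SignCut RhW08.IsolatedTilt RhW08.Lens1Pinning RhW08.Lens1PinningIso
open RhW08.Lens1ArcSign

/-- ★ Vertical-segment monotonicity: `Im φ x = 0`, `0 < Re φ′` on `{x + i t : 0 ≤ t ≤ y}` ⇒ `0 < Im φ (x + i y)`. -/
theorem im_pos_above_of_re_deriv_pos {φ : ℂ → ℂ} {x y : ℝ} (hy : 0 < y)
    (hd : ∀ t ∈ Icc (0 : ℝ) y, DifferentiableAt ℂ φ ((x : ℂ) + (t : ℂ) * I))
    (hx : (φ (x : ℂ)).im = 0)
    (hpos : ∀ t ∈ Icc (0 : ℝ) y, 0 < (deriv φ ((x : ℂ) + (t : ℂ) * I)).re) :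
    0 < (φ ((x : ℂ) + (y : ℂ) * I)).im := by
  set g : ℝ → ℝ := fun t => (φ ((x : ℂ) + (t : ℂ) * I)).im with hg
  have hder : ∀ t ∈ Icc (0 : ℝ) y, HasDerivAt g ((deriv φ ((x : ℂ) + (t : ℂ) * I)).re) t := by
    intro t ht
    have h1 : HasDerivAt (fun s : ℝ => (x : ℂ) + (s : ℂ) * I) I t := by
      have h0 : HasDerivAt (fun s : ℝ => ((id s : ℝ) : ℂ)) ((1 : ℝ) : ℂ) t := (hasDerivAt_id t).ofReal_comp
      simpa using (h0.mul_const I).const_add (x : ℂ)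
    have h2 : HasDerivAt (fun s : ℝ => φ ((x : ℂ) + (s : ℂ) * I)) (deriv φ ((x : ℂ) + (t : ℂ) * I) * I) t :=
      (hd t ht).hasDerivAt.comp t h1
    have h3 := (Complex.imCLM.hasFDerivAt).comp_hasDerivAt t h2
    have h4 : (Complex.imCLM : ℂ → ℝ) ∘ (fun s : ℝ => φ ((x : ℂ) + (s : ℂ) * I)) = g := by
      funext s; simp [g]
    rw [h4] at h3
    simpa [Complex.mul_im] using h3
  have hcont : ContinuousOn g (Icc 0 y) := fun t ht => (hder t ht).continuousAt.continuousWithinAt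
  have hmono : StrictMonoOn g (Icc 0 y) := by
    refine strictMonoOn_of_deriv_pos (convex_Icc 0 y) hcont ?_
    intro t ht
    rw [interior_Icc] at ht
    rw [(hder t (Ioo_subset_Icc_self ht)).deriv]
    exact hpos t (Ioo_subset_Icc_self ht)
  have h0y : g 0 < g y := hmono (left_mem_Icc.2 hy.le) (right_mem_Icc.2 hy.le) hy
  have hg0 : g 0 = 0 := by simp [g, hx]
  simpa [g, hg0] using h0y

/-- ★ FIRST-CONTACT COROLLARY («NoLanding») over part N's `LinkCore`: hypotheses — the core clauses on `Ioo 0 1` (nodality is the one used), `s₀ ∈ (0,1)`,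
`σ` continuous at `s₀` within `Iio s₀`, `Im σ s > 0` for `s ∈ (s₁, s₀)` (`s₁ < s₀`), `Im σ s₀ = 0`; and a BOX of half-width `δ` above `x⋆ = Re σ s₀` on which
`φ = phiAt f j` is ℂ-differentiable with `0 < Re φ′`, `φ` real at the real points of the box.  Conclusion: `False`. -/
theorem linkCore_noLanding {f : ℂ → ℂ} {j : ℕ} {a : ℂ} {σ : ℝ → ℂ} {s₀ s₁ δ : ℝ}
    (hL : LinkCore f j a σ (Ioo 0 1)) (hs₀ : s₀ ∈ Ioo (0 : ℝ) 1) (hs₁ : s₁ < s₀)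
    (hσ : ContinuousWithinAt σ (Iio s₀) s₀)
    (habove : ∀ s ∈ Ioo s₁ s₀, 0 < (σ s).im) (hland : (σ s₀).im = 0) (hδ : 0 < δ)
    (hdiff : ∀ z : ℂ, |z.re - (σ s₀).re| < δ → 0 ≤ z.im → z.im < δ → DifferentiableAt ℂ (phiAt f j) z)
    (hre : ∀ z : ℂ, |z.re - (σ s₀).re| < δ → 0 ≤ z.im → z.im < δ → 0 < (deriv (phiAt f j) z).re)
    (hreal : ∀ u : ℝ, |u - (σ s₀).re| < δ → (phiAt f j (u : ℂ)).im = 0) : False := by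
  -- points σ s with s < s₀ close to s₀ lie within δ of σ s₀
  have hnear : ∀ᶠ s in nhdsWithin s₀ (Iio s₀), dist (σ s) (σ s₀) < δ :=
    (Metric.tendsto_nhds.1 hσ.tendsto) δ hδ
  have hIoo : ∀ᶠ s in nhdsWithin s₀ (Iio s₀), s ∈ Ioo s₁ s₀ :=
    Ioo_mem_nhdsLT hs₁
  have hIoo' : ∀ᶠ s in nhdsWithin s₀ (Iio s₀), s ∈ Ioo (0 : ℝ) s₀ :=
    Ioo_mem_nhdsLT hs₀.1
  obtain ⟨s, hds, hs, hs'⟩ := (hnear.and (hIoo.and hIoo')).exists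
  have hs01 : s ∈ Ioo (0 : ℝ) 1 := ⟨hs'.1, hs'.2.trans hs₀.2⟩
  have him : 0 < (σ s).im := habove s hs
  -- the box conditions at σ s
  have hdist : ‖σ s - σ s₀‖ < δ := by simpa [dist_eq_norm] using hds
  have hrebd : |(σ s).re - (σ s₀).re| < δ :=
    lt_of_le_of_lt (by simpa using abs_re_le_norm (σ s - σ s₀)) hdist
  have himbd : (σ s).im < δ := by
    have h1 : |(σ s).im - (σ s₀).im| ≤ ‖σ s - σ s₀‖ := by simpa using abs_im_le_norm (σ s - σ s₀)
    rw [hland, sub_zero] at h1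
    exact lt_of_le_of_lt (le_trans (le_abs_self _) h1) hdist
  -- apply the segment lemma at x = Re σ s, y = Im σ s
  have key := im_pos_above_of_re_deriv_pos (φ := phiAt f j) (x := (σ s).re) (y := (σ s).im) him
    (fun t ht => hdiff _ (by simpa using hrebd) (by simpa using ht.1) (by simpa using lt_of_le_of_lt ht.2 himbd))
    (hreal _ hrebd)
    (fun t ht => hre _ (by simpa using hrebd) (by simpa using ht.1) (by simpa using lt_of_le_of_lt ht.2 himbd))
  rw [Complex.re_add_im] at key
  exact absurd (hL s hs01).2.2.2.1 key.ne'

/-- ★★ NO HALF-LINK FROM `a` (NEG-20 analytic half, PROVED): on a legal frame, a SIMPLE upper zero `a` of `f⁽ʲ⁾` admits no half-link (part N) once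
(i) no zero of `f⁽ʲ⁺¹⁾` lies in `a`ʼs closed Jensen disc strictly above the axis, and (ii) `φ = phiAt f j` is ℂ-differentiable with `0 < Re φ′` on the
strip `{z | |Re z − Re a| < Im a + δ, 0 ≤ Im z < δ}` above the `δ`-widened base.  ((i), (ii) are the algebraic certificates — for the symmetric wall
`{±i, ±17/10 ± 7/8·i}` at tilt 0: two rational inequalities and one Sturm sign.)  Proof: the pay point `σ t` of part Nʼs `exists_eq_zero_of_link` is a zero
of `f⁽ʲ⁺¹⁾` in the disc; off the axis it contradicts (i); on the axis the path has a FIRST CONTACT `s₀ = inf {s ≤ t | Im σ s = 0} > 0` and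
`linkCore_noLanding` applies in the box of half-width `δ` above `Re σ s₀` (inside the strip since `|Re σ s₀ − Re a| ≤ Im a`). -/
theorem not_halfLink_of_noLanding {η : ℝ} {f : ℂ → ℂ} {x₀ s hmax R Hs : ℝ} {B : ℕ} (hE : EngineHyps5 2 η f x₀ s hmax R Hs B)
    {j : ℕ} {a : ℂ} {δ : ℝ} (ha : iteratedDeriv j f a = 0) (hda : iteratedDeriv (j + 1) f a ≠ 0) (ha0 : 0 < a.im)
    (hnr : ∀ z : ℂ, NestedStep a z → 0 < z.im → iteratedDeriv (j + 1) f z ≠ 0) (hδ : 0 < δ)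
    (hdiff : ∀ z : ℂ, |z.re - a.re| < a.im + δ → 0 ≤ z.im → z.im < δ → DifferentiableAt ℂ (phiAt f j) z)
    (hre : ∀ z : ℂ, |z.re - a.re| < a.im + δ → 0 ≤ z.im → z.im < δ → 0 < (deriv (phiAt f j) z).re) :
    ¬ HalfLink f j a := by
  classical
  intro hL
  have hG : RealEntireLt2 (iteratedDeriv j f) := RhW08.WindowLoss.realEntireLt2_iteratedDeriv (realEntireLt2_of_hyps hE) j
  have hG1 : RealEntireLt2 (iteratedDeriv (j + 1) f) := RhW08.WindowLoss.realEntireLt2_iteratedDeriv (realEntireLt2_of_hyps hE) (j + 1)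
  have hG'd := differentiable_deriv_iteratedDeriv hE j
  have e1 : deriv (iteratedDeriv j f) = iteratedDeriv (j + 1) f := by rw [← iteratedDeriv_succ]
  have hreal : ∀ u : ℝ, (phiAt f j (u : ℂ)).im = 0 := by
    intro u
    have h1 : (iteratedDeriv j f (u : ℂ)).im = 0 := hG.real u
    have h2 : (deriv (iteratedDeriv j f) (u : ℂ)).im = 0 := by rw [e1]; exact hG1.real u
    simp [phiAt, Complex.div_im, h1, h2]
  obtain ⟨κ, hκ, σ, σ', hσ0, hσ, hcore, hsign, s₂, hs₂, hpos⟩ := hL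
  have hκ0 : (κ : ℂ) ≠ 0 := by rcases hκ with rfl | rfl <;> simp
  obtain ⟨hψd, hnodal, hleft, hnorm⟩ := link_hyps hE hκ hcore hsign
  have hne : ∀ s ∈ Ioo (0 : ℝ) 1, iteratedDeriv j f (σ s) ≠ 0 := fun s hs => (hcore s hs).2.2.1
  have hblow : ∀ M : ℝ, ∃ δ : ℝ, 0 < δ ∧ ∀ s ∈ Ioo (0 : ℝ) 1, s < δ → M < ‖(fun z => (κ : ℂ) * phiAt f j z) (σ s)‖ := by
    intro M
    obtain ⟨δ, hδ, h⟩ := norm_logDeriv_large_near hG.diff hG'd ha (by rwa [e1]) (hσ 0 ⟨le_rfl, zero_le_one⟩).continuousAt hσ0 M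
    exact ⟨δ, hδ, fun s hs hsδ => by rw [hnorm]; exact h s (by rwa [sub_zero, abs_of_pos hs.1]) (hne s hs)⟩
  have hpos' : 0 ≤ ((fun z => (κ : ℂ) * phiAt f j z) (σ s₂)).re := by simpa [Complex.re_ofReal_mul] using hpos
  obtain ⟨t, ht, hψ0⟩ := exists_eq_zero_of_link hσ hψd hnodal hleft hblow hs₂ hpos'
  have htI : t ∈ Ioo (0 : ℝ) 1 := ⟨ht.1, ht.2.trans_lt hs₂.2⟩
  obtain ⟨hmem, him0, hGne, -, -⟩ := hcore t htI
  have hφ0 : phiAt f j (σ t) = 0 := (mul_eq_zero.mp hψ0).resolve_left hκ0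
  have hzero : iteratedDeriv (j + 1) f (σ t) = 0 := by
    unfold phiAt at hφ0
    have := (div_eq_zero_iff.mp hφ0).resolve_right hGne
    rwa [e1] at this
  by_cases hw : (σ t).im = 0
  swap
  · exact hnr (σ t) hmem (lt_of_le_of_ne him0 (Ne.symm hw)) hzero
  -- the path touches the axis at `t`: FIRST CONTACT `s₀`
  have hcont : ContinuousOn σ (Icc 0 1) := fun s hs => (hσ s hs).continuousAt.continuousWithinAt
  set S : Set ℝ := Icc 0 t ∩ (fun s => (σ s).im) ⁻¹' {0} with hS
  have hSclosed : IsClosed S := by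
    have hc : ContinuousOn (fun s => (σ s).im) (Icc 0 t) :=
      Complex.continuous_im.comp_continuousOn (hcont.mono (Icc_subset_Icc_right (ht.2.trans hs₂.2.le)))
    exact hc.preimage_isClosed_of_isClosed isClosed_Icc isClosed_singleton
  have htS : t ∈ S := ⟨⟨ht.1.le, le_rfl⟩, hw⟩
  have hSne : S.Nonempty := ⟨t, htS⟩
  have hSbdd : BddBelow S := ⟨0, fun s hs => hs.1.1⟩
  have hs₀S : sInf S ∈ S := hSclosed.csInf_mem hSne hSbdd
  have hs₀t : sInf S ≤ t := csInf_le hSbdd htS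
  have hland : (σ (sInf S)).im = 0 := hs₀S.2
  have hs₀pos : 0 < sInf S := by
    rcases hs₀S.1.1.lt_or_eq with h | h
    · exact h
    · exfalso
      have h0 : (σ 0).im = 0 := by have h' := hland; rwa [← h] at h'
      rw [hσ0] at h0
      exact absurd h0 ha0.ne'
  have hs₀I : sInf S ∈ Ioo (0 : ℝ) 1 := ⟨hs₀pos, hs₀t.trans_lt htI.2⟩
  have habove : ∀ s ∈ Ioo 0 (sInf S), 0 < (σ s).im := by
    intro s hs
    have hsI : s ∈ Ioo (0 : ℝ) 1 := ⟨hs.1, hs.2.trans hs₀I.2⟩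
    have hns : s ∉ S := fun hsS => (not_le.mpr hs.2) (csInf_le hSbdd hsS)
    have him : (σ s).im ≠ 0 := fun h0 => hns ⟨⟨hs.1.le, hs.2.le.trans hs₀t⟩, h0⟩
    exact lt_of_le_of_ne (hcore s hsI).2.1 (Ne.symm him)
  have hσw : ContinuousWithinAt σ (Iio (sInf S)) (sInf S) :=
    (hσ (sInf S) ⟨hs₀I.1.le, hs₀I.2.le⟩).continuousAt.continuousWithinAt
  -- the box of half-width δ above `Re σ s₀` lies in the strip
  have hxa : |(σ (sInf S)).re - a.re| ≤ a.im := by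
    have hn := (hcore (sInf S) hs₀I).1
    unfold NestedStep at hn
    rw [hland] at hn
    have hn' : ((σ (sInf S)).re - a.re) ^ 2 ≤ a.im ^ 2 := by nlinarith [hn]
    exact abs_le.mpr ⟨by nlinarith [hn', ha0], by nlinarith [hn', ha0]⟩
  have hbox : ∀ z : ℂ, |z.re - (σ (sInf S)).re| < δ → |z.re - a.re| < a.im + δ := by
    intro z hz
    have h1 := abs_lt.mp hz
    have h2 := abs_le.mp hxa
    exact abs_lt.mpr ⟨by linarith [h1.1, h2.1], by linarith [h1.2, h2.2]⟩
  exact linkCore_noLanding hcore hs₀I hs₀pos hσw habove hland hδ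
    (fun z h1 h2 h3 => hdiff z (hbox z h1) h2 h3) (fun z h1 h2 h3 => hre z (hbox z h1) h2 h3) (fun u _ => hreal u)

/-- ★★★ BASE-SLOPE FORM (PROVED; the certificate-light variant): on a legal frame, a SIMPLE upper zero `a` of `f⁽ʲ⁾` admits NO half-link once
(i) no zero of `f⁽ʲ⁺¹⁾` lies in `a`ʼs closed Jensen disc strictly above the axis, and (ii) at every tooth-free point `u` of the CLOSED BASE
(`|u − Re a| ≤ Im a`, `f⁽ʲ⁾ u ≠ 0`) the base slope is positive: `0 < Re φ′(u)`, `φ = phiAt f j`.  ((ii) is the ONE-DIMENSIONAL fact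
`H = f⁽ʲ⁾·f⁽ʲ⁺²⁾ − (f⁽ʲ⁺¹⁾)² > 0` on the tooth-free base — one Sturm sign; the δ-strip of `not_halfLink_of_noLanding` is produced here from continuity of
`φ′` at the first-contact point: `φ` is analytic off the zeros of `f⁽ʲ⁾`, so `φ′` is continuous there.) -/
theorem not_halfLink_of_baseSlope {η : ℝ} {f : ℂ → ℂ} {x₀ s hmax R Hs : ℝ} {B : ℕ} (hE : EngineHyps5 2 η f x₀ s hmax R Hs B)
    {j : ℕ} {a : ℂ} (ha : iteratedDeriv j f a = 0) (hda : iteratedDeriv (j + 1) f a ≠ 0) (ha0 : 0 < a.im)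
    (hnr : ∀ z : ℂ, NestedStep a z → 0 < z.im → iteratedDeriv (j + 1) f z ≠ 0)
    (hbase : ∀ u : ℝ, |u - a.re| ≤ a.im → iteratedDeriv j f (u : ℂ) ≠ 0 → 0 < (deriv (phiAt f j) (u : ℂ)).re) :
    ¬ HalfLink f j a := by
  classical
  intro hL
  have hG : RealEntireLt2 (iteratedDeriv j f) := RhW08.WindowLoss.realEntireLt2_iteratedDeriv (realEntireLt2_of_hyps hE) j
  have hG1 : RealEntireLt2 (iteratedDeriv (j + 1) f) := RhW08.WindowLoss.realEntireLt2_iteratedDeriv (realEntireLt2_of_hyps hE) (j + 1)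
  have hG'd := differentiable_deriv_iteratedDeriv hE j
  have e1 : deriv (iteratedDeriv j f) = iteratedDeriv (j + 1) f := by rw [← iteratedDeriv_succ]
  have hreal : ∀ u : ℝ, (phiAt f j (u : ℂ)).im = 0 := by
    intro u
    have h1 : (iteratedDeriv j f (u : ℂ)).im = 0 := hG.real u
    have h2 : (deriv (iteratedDeriv j f) (u : ℂ)).im = 0 := by rw [e1]; exact hG1.real u
    simp [phiAt, Complex.div_im, h1, h2]
  -- φ is ℂ-differentiable off the zeros of f⁽ʲ⁾
  have hφd : ∀ z : ℂ, iteratedDeriv j f z ≠ 0 → DifferentiableAt ℂ (phiAt f j) z := by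
    intro z hz
    have : DifferentiableAt ℂ (fun w => deriv (iteratedDeriv j f) w / iteratedDeriv j f w) z := ((hG'd z).div (hG.diff z) hz)
    exact this
  obtain ⟨κ, hκ, σ, σ', hσ0, hσ, hcore, hsign, s₂, hs₂, hpos⟩ := hL
  have hκ0 : (κ : ℂ) ≠ 0 := by rcases hκ with rfl | rfl <;> simp
  obtain ⟨hψd, hnodal, hleft, hnorm⟩ := link_hyps hE hκ hcore hsign
  have hne : ∀ s ∈ Ioo (0 : ℝ) 1, iteratedDeriv j f (σ s) ≠ 0 := fun s hs => (hcore s hs).2.2.1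
  have hblow : ∀ M : ℝ, ∃ δ : ℝ, 0 < δ ∧ ∀ s ∈ Ioo (0 : ℝ) 1, s < δ → M < ‖(fun z => (κ : ℂ) * phiAt f j z) (σ s)‖ := by
    intro M
    obtain ⟨δ, hδ, h⟩ := norm_logDeriv_large_near hG.diff hG'd ha (by rwa [e1]) (hσ 0 ⟨le_rfl, zero_le_one⟩).continuousAt hσ0 M
    exact ⟨δ, hδ, fun s hs hsδ => by rw [hnorm]; exact h s (by rwa [sub_zero, abs_of_pos hs.1]) (hne s hs)⟩
  have hpos' : 0 ≤ ((fun z => (κ : ℂ) * phiAt f j z) (σ s₂)).re := by simpa [Complex.re_ofReal_mul] using hpos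
  obtain ⟨t, ht, hψ0⟩ := exists_eq_zero_of_link hσ hψd hnodal hleft hblow hs₂ hpos'
  have htI : t ∈ Ioo (0 : ℝ) 1 := ⟨ht.1, ht.2.trans_lt hs₂.2⟩
  obtain ⟨hmem, him0, hGne, -, -⟩ := hcore t htI
  have hφ0 : phiAt f j (σ t) = 0 := (mul_eq_zero.mp hψ0).resolve_left hκ0
  have hzero : iteratedDeriv (j + 1) f (σ t) = 0 := by
    unfold phiAt at hφ0
    have := (div_eq_zero_iff.mp hφ0).resolve_right hGne
    rwa [e1] at this
  by_cases hw : (σ t).im = 0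
  swap
  · exact hnr (σ t) hmem (lt_of_le_of_ne him0 (Ne.symm hw)) hzero
  -- FIRST CONTACT s₀ (as in `not_halfLink_of_noLanding`)
  have hcont : ContinuousOn σ (Icc 0 1) := fun s hs => (hσ s hs).continuousAt.continuousWithinAt
  set S : Set ℝ := Icc 0 t ∩ (fun s => (σ s).im) ⁻¹' {0} with hS
  have hSclosed : IsClosed S := by
    have hc : ContinuousOn (fun s => (σ s).im) (Icc 0 t) :=
      Complex.continuous_im.comp_continuousOn (hcont.mono (Icc_subset_Icc_right (ht.2.trans hs₂.2.le)))
    exact hc.preimage_isClosed_of_isClosed isClosed_Icc isClosed_singleton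
  have htS : t ∈ S := ⟨⟨ht.1.le, le_rfl⟩, hw⟩
  have hSne : S.Nonempty := ⟨t, htS⟩
  have hSbdd : BddBelow S := ⟨0, fun s hs => hs.1.1⟩
  have hs₀S : sInf S ∈ S := hSclosed.csInf_mem hSne hSbdd
  have hs₀t : sInf S ≤ t := csInf_le hSbdd htS
  have hland : (σ (sInf S)).im = 0 := hs₀S.2
  have hs₀pos : 0 < sInf S := by
    rcases hs₀S.1.1.lt_or_eq with h | h
    · exact h
    · exfalso
      have h0 : (σ 0).im = 0 := by have h' := hland; rwa [← h] at h'
      rw [hσ0] at h0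
      exact absurd h0 ha0.ne'
  have hs₀I : sInf S ∈ Ioo (0 : ℝ) 1 := ⟨hs₀pos, hs₀t.trans_lt htI.2⟩
  have habove : ∀ s ∈ Ioo 0 (sInf S), 0 < (σ s).im := by
    intro s hs
    have hsI : s ∈ Ioo (0 : ℝ) 1 := ⟨hs.1, hs.2.trans hs₀I.2⟩
    have hns : s ∉ S := fun hsS => (not_le.mpr hs.2) (csInf_le hSbdd hsS)
    have him : (σ s).im ≠ 0 := fun h0 => hns ⟨⟨hs.1.le, hs.2.le.trans hs₀t⟩, h0⟩
    exact lt_of_le_of_ne (hcore s hsI).2.1 (Ne.symm him)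
  have hσw : ContinuousWithinAt σ (Iio (sInf S)) (sInf S) :=
    (hσ (sInf S) ⟨hs₀I.1.le, hs₀I.2.le⟩).continuousAt.continuousWithinAt
  -- the first-contact point x⋆ is a tooth-free point of the closed base
  set xs : ℝ := (σ (sInf S)).re with hxs
  have hσx : σ (sInf S) = (xs : ℂ) := Complex.ext (by simp [xs]) (by simp [hland])
  have hxa : |xs - a.re| ≤ a.im := by
    have hn := (hcore (sInf S) hs₀I).1
    unfold NestedStep at hn
    rw [hland] at hn
    have hn' : ((σ (sInf S)).re - a.re) ^ 2 ≤ a.im ^ 2 := by nlinarith [hn]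
    exact abs_le.mpr ⟨by nlinarith [hn', ha0], by nlinarith [hn', ha0]⟩
  have hGx : iteratedDeriv j f (xs : ℂ) ≠ 0 := by rw [← hσx]; exact (hcore (sInf S) hs₀I).2.2.1
  have hslope : 0 < (deriv (phiAt f j) (xs : ℂ)).re := hbase xs hxa hGx
  -- continuity: f⁽ʲ⁾ ≠ 0 and 0 < Re φ′ on a ball around x⋆
  have hU : ∀ᶠ z in nhds (xs : ℂ), iteratedDeriv j f z ≠ 0 :=
    (hG.diff.continuous.continuousAt).eventually_ne hGx
  have hA : AnalyticAt ℂ (phiAt f j) (xs : ℂ) := by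
    refine DifferentiableOn.analyticAt (s := {z | iteratedDeriv j f z ≠ 0}) ?_ ?_
    · exact fun z hz => (hφd z hz).differentiableWithinAt
    · exact (isOpen_ne_fun hG.diff.continuous continuous_const).mem_nhds hGx
  have hcφ' : ContinuousAt (fun z => (deriv (phiAt f j) z).re) (xs : ℂ) :=
    Complex.continuous_re.continuousAt.comp hA.deriv.continuousAt
  have hV : ∀ᶠ z in nhds (xs : ℂ), 0 < (deriv (phiAt f j) z).re :=
    hcφ'.preimage_mem_nhds (Ioi_mem_nhds hslope)
  obtain ⟨r, hr, hball⟩ := Metric.mem_nhds_iff.mp (hU.and hV)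
  -- the box of half-width r/2 above x⋆ lies in the ball
  have hbox : ∀ z : ℂ, |z.re - xs| < r / 2 → 0 ≤ z.im → z.im < r / 2 → z ∈ Metric.ball (xs : ℂ) r := by
    intro z h1 h2 h3
    rw [Metric.mem_ball, dist_eq_norm]
    have hle := Complex.norm_le_abs_re_add_abs_im (z - (xs : ℂ))
    have e2 : (z - (xs : ℂ)).re = z.re - xs := by simp
    have e3 : (z - (xs : ℂ)).im = z.im := by simp
    rw [e2, e3, abs_of_nonneg h2] at hle
    linarith
  refine linkCore_noLanding (δ := r / 2) hcore hs₀I hs₀pos hσw habove hland (by positivity)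
    (fun z h1 h2 h3 => hφd z (hball (hbox z (by simpa [xs] using h1) h2 h3)).1)
    (fun z h1 h2 h3 => (hball (hbox z (by simpa [xs] using h1) h2 h3)).2) (fun u _ => hreal u)

end RhW08.Lens1NoLanding
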